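import Summits.QuantumAdvantage.AdviceFreeQNC0.WalkTubeRank
import Summits.QuantumAdvantage.AdviceFreeQNC0.WalkTubeMass
import Summits.QuantumAdvantage.AdviceFreeQNC0.BinomialTailLower
import HarnessLib

/-!
# Cell qa-qnc0 (rung F-Q1, route `RingFrame`): walk hardness on the whole sub-`√n` degree range
# with ONE threshold (the tube bound's true range; qn-p2 ROUND-11 §1 Remark (a), §8.5)

`walkHard_of_deg_le_sqrt`: there are `θ < 1` and `n₀` with: for all `n ≥ n₀`, EVERY degree
`D ≤ ⌊√n⌋`, every charge and every walk strategy `y` of `𝔽₂`-degree `≤ D` at every cut, `y` wins the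
walk game on at most `θ·2ⁿ` inputs (`θ = 1 − c/2`, `c` from `binomTailLower` at `C₁ + 1`, `C₁ = 6` from
`tubeMass`).  Same proof as `tubePlan` (`WalkTubeRank.lean`) with the polylog degree replaced by any
`D ≤ ⌊√n⌋` — the only place the degree entered was `D ≤ ⌊√n⌋`.  Intended consumer: the next rung
(qn-p2 `Sketch12.RingHardSubSqrt` / Grewal–Kumar's regime `k = N^{1/(2d)−ε}`), modulo the degree cost
of the ring-to-walk transport.  WHAT THIS IS NOT: no statement beyond degree `√n` (the linear regime
`n ≥ λD` with failure `2^{−O(D/λ)}` is qn-prover-3's `WalkTubeLinear`); nothing on the summit.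
-/

noncomputable section

open Classical

namespace Summit.QuantumAdvantage.AdviceFreeQNC0

open Finset
open Literature.Computability.MetaComplexity Literature.Computability.MetaComplexity.Smolensky
open F4

/-- **Walk hardness on the whole sub-√n range with ONE threshold** (the tube bound's true range):
there are `θ < 1` and `n₀` such that for all `n ≥ n₀`, every `D ≤ ⌊√n⌋`, every charge and every walk
strategy `y` with `HasDeg (y g) D` for all cuts, `y` wins on at most `θ·2ⁿ` inputs. -/
theorem walkHard_of_deg_le_sqrt : ∃ θ : ℝ, θ < 1 ∧ ∃ n₀ : ℕ, ∀ n ≥ n₀, ∀ D ≤ Nat.sqrt n,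
    ∀ ch : ℕ, ∀ y : Fin (n + 1) → (Fin n → Bool) → Bool, (∀ g, HasDeg (y g) D) →
      ((univ.filter fun u : Fin n → Bool => ringWinU ch y u = true).card : ℝ) ≤ θ * (2 : ℝ) ^ n := by
  obtain ⟨C₁, m₀, hmass⟩ := tubeMass
  obtain ⟨c, hc, m₁, htail⟩ := binomTailLower (C₁ + 1)
  refine ⟨1 - c / 2, by linarith, max (max m₀ m₁) (4 * (C₁ + 1) ^ 2), fun n hn D hDs ch y hy => ?_⟩
  have hm₀ : m₀ ≤ n := le_trans (le_trans (le_max_left _ _) (le_max_left _ _)) hn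
  have hm₁ : m₁ ≤ n := le_trans (le_trans (le_max_right _ _) (le_max_left _ _)) hn
  have hbig : 4 * (C₁ + 1) ^ 2 ≤ n := le_trans (le_max_right _ _) hn
  set s := Nat.sqrt n with hs
  have hs2 : 2 * (C₁ + 1) ≤ s := by
    rw [hs, Nat.le_sqrt]
    nlinarith
  have hss : s * s ≤ n := Nat.sqrt_le n
  have hfit2 : 2 * (D + C₁ * s) ≤ n := by nlinarith
  have hfit : D + C₁ * s ≤ n / 2 := by omega
  set D' := n / 2 - C₁ * s - D with hD'
  have hsum : D' + D = n / 2 - C₁ * s := by omega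
  have ht : n / 2 - (C₁ * s + D) = D' := by omega
  have htle : C₁ * s + D ≤ (C₁ + 1) * s := by nlinarith
  have hf : stratFun ch y ∈ fullSpan n D := stratFun_mem_fullSpan ch y hy
  have h₃ := tubeBound n D D' (stratFun ch y) hf
  rw [hsum] at h₃
  have h₄ := hmass n hm₀
  have h₅ := htail n hm₁ (C₁ * s + D) htle
  rw [ht] at h₅
  set FAR := (farSet n (n / 2 - C₁ * s)).card with hFAR
  set N := numMonomials n D' with hN
  set FAIL := (failSetOf (stratFun ch y)).card with hFAIL
  have h2n : (0 : ℝ) < (2 : ℝ) ^ n := by positivity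
  have h₃R : (FAR : ℝ) * N ≤ (2 : ℝ) ^ n * FAIL := by exact_mod_cast h₃
  have h₄R : (2 : ℝ) ^ n ≤ 2 * FAR := by exact_mod_cast h₄
  have hfail : c / 2 * (2 : ℝ) ^ n ≤ FAIL := by
    have step1 : (2 : ℝ) ^ n / 2 * (c * (2 : ℝ) ^ n) ≤ (FAR : ℝ) * N :=
      mul_le_mul (by linarith) h₅ (by positivity) (Nat.cast_nonneg _)
    have step2 : (2 : ℝ) ^ n * (c / 2 * (2 : ℝ) ^ n) ≤ (2 : ℝ) ^ n * FAIL := by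
      calc (2 : ℝ) ^ n * (c / 2 * (2 : ℝ) ^ n) = (2 : ℝ) ^ n / 2 * (c * (2 : ℝ) ^ n) := by ring
        _ ≤ (FAR : ℝ) * N := step1
        _ ≤ (2 : ℝ) ^ n * FAIL := h₃R
    exact le_of_mul_le_mul_left step2 h2n
  have hwin := TubePlanProof.card_win_add_card_failSetOf ch y
  have hwinR : ((univ.filter fun u : Fin n → Bool => ringWinU ch y u = true).card : ℝ) + FAIL =
      (2 : ℝ) ^ n := by
    rw [hFAIL]; exact_mod_cast hwin
  linarith

end Summit.QuantumAdvantage.AdviceFreeQNC0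

end
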